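import Literature.NumberTheory.LFunctions.LagariasDifferencedXiSpacings
import Literature.NumberTheory.LFunctions.ZetaLogDerivVKBound
import Mathlib.Analysis.SpecialFunctions.Pow.Asymptotics
import HarnessLib

/-!
# Lagarias 2005, Lemma 4.1 (2): `R_{1/2}(T) = O(log T / log log T)` — PROOF

LABEL (line 1): RH-FREE corpus discharge. bears_on: LADDER-RH B-C/B-P (COLUMN 6 DBR, Lagarias'
differenced-`ξ` programme; cell rh-crit/dbl row «dbl:S-La4»). WHAT THIS IS NOT: an unconditional
bound for `ζ′/ζ` on the line `σ = 1`; nothing about zeros of `ξ` or about RH — nothing here bears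
on the truth of RH.

Proofs only (no definition, no named fact). Discharges the named fact
`Literature.NumberTheory.LFunctions.lagarias2005_lemma_4_1_2` of
`LagariasDifferencedXiSpacings.lean` (J. C. Lagarias, *Zero spacing distributions for differenced
L-functions*, Acta Arith. 120 (2005), Lemma 4.1 (2), p. 8: "`R_{1/2}(T) = O(log T/log log T)`,
shown in Titchmarsh [Thm 5.17, (5.17.4)]"), where
`R_h(T) = sup_{T ≤ t ≤ T+1} |ζ′/ζ(½ + h + it)|` (`zetaLogDerivSup`).

## The argument

The sibling module `ZetaLogDerivVKBound.lean` proves, from the tree's Richert-type bound and the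
Vinogradov–Korobov zero-free region (Landau's method),
`|ζ′/ζ(1 + it)| ≤ C (log t)^{2/3}(log log t)^{4/3}` for `t ≥ 22`
(`ZetaLogDerivVK.norm_logDeriv_zeta_one_le`). For `T ≤ t ≤ T + 1`, `log t ≤ log(T²) = 2 log T` and
`log log t ≤ 2 log log T`, so the supremum over `[T, T+1]` is `≤ 4C (log T)^{2/3}(log log T)^{4/3}`,
and `(log T)^{2/3}(log log T)^{4/3} ≤ log T/log log T` as soon as `(log log T)^{7/3} ≤ (log T)^{1/3}`,
which holds for all large `T` (`log x = o(x^{1/7})`, Mathlib's `isLittleO_log_rpow_rpow_atTop`). Hence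
`R_{1/2}(T) ≤ 4C · log T/log log T` eventually: the printed `O(log T/log log T)` (indeed
`R_{1/2}(T) = o(log T/log log T)`).

## Main result

* `Literature.NumberTheory.LFunctions.lagarias2005_lemma_4_1_2_holds : lagarias2005_lemma_4_1_2`.

## References

* [Lagarias2005] J. C. Lagarias, Acta Arith. 120 (2005) 159–184 = arXiv:math/0601653, Lemma 4.1 (2).
* [Titchmarsh1986] E. C. Titchmarsh, *The theory of the Riemann zeta-function*, 2nd ed.
  (Heath-Brown), Theorem 3.11, Theorem 5.17 (5.17.4), §6.19.
-/

noncomputable section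

open Complex Set Filter Asymptotics
open scoped Topology

namespace Literature.NumberTheory.LFunctions

namespace Lagarias2005LogDeriv

/-- `(log log T)^{7/3} ≤ (log T)^{1/3}` for all large `T` (`(log x)^{7/3} = o(x^{1/3})` at `x = log T`).
[folklore] -/
private theorem eventually_loglog_rpow_le :
    ∀ᶠ T : ℝ in atTop, Real.log (Real.log T) ^ (7 / 3 : ℝ) ≤ Real.log T ^ (1 / 3 : ℝ) := by
  have h := ((isLittleO_log_rpow_rpow_atTop (7 / 3 : ℝ) (by norm_num : (0 : ℝ) < 1 / 3)).comp_tendsto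
    Real.tendsto_log_atTop).def (by norm_num : (0 : ℝ) < 1)
  filter_upwards [h, eventually_ge_atTop (3 : ℝ)] with T hT hT3
  have hL1 : 1 ≤ Real.log T := VKFromRichert.one_le_log hT3
  have hll0 : 0 ≤ Real.log (Real.log T) := Real.log_nonneg hL1
  simp only [Function.comp, one_mul, Real.norm_eq_abs] at hT
  rwa [abs_of_nonneg (Real.rpow_nonneg hll0 _),
    abs_of_nonneg (Real.rpow_nonneg (by linarith) _)] at hT

/-- The pointwise bound on `[T, T+1]` in the printed gauge: if
`|ζ′/ζ(1+it)| ≤ C (log t)^{2/3}(log log t)^{4/3}` for `t ≥ 22`, then for `T ≥ 22` with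
`(log log T)^{7/3} ≤ (log T)^{1/3}` and `T ≤ t ≤ T + 1`:
`|ζ′/ζ(1+it)| ≤ 4C · log T/log log T`. [folklore] -/
private theorem norm_logDeriv_le_gauge {C : ℝ} (hC : 0 < C)
    (hb : ∀ t : ℝ, 22 ≤ |t| → ‖deriv riemannZeta (1 + t * I) / riemannZeta (1 + t * I)‖ ≤
      C * Real.log |t| ^ (2 / 3 : ℝ) * Real.log (Real.log |t|) ^ (4 / 3 : ℝ))
    {T : ℝ} (hT : 22 ≤ T) (hll : Real.log (Real.log T) ^ (7 / 3 : ℝ) ≤ Real.log T ^ (1 / 3 : ℝ))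
    {t : ℝ} (ht : t ∈ Icc T (T + 1)) :
    ‖deriv riemannZeta (1 + t * I) / riemannZeta (1 + t * I)‖ ≤
      4 * C * (Real.log T / Real.log (Real.log T)) := by
  set L : ℝ := Real.log T with hLdef
  have hT0 : 0 < T := by linarith
  have ht0 : 0 < t := by linarith [ht.1]
  have hL3 : 3 ≤ L := VKFromRichert.three_le_log_of_ge (by linarith)
  have hL0 : 0 < L := by linarith
  have hlogL1 : 1 ≤ Real.log L := VKFromRichert.one_le_log hL3
  have hlogL0 : 0 < Real.log L := by linarith
  have ht22 : 22 ≤ |t| := by rw [abs_of_pos ht0]; linarith [ht.1]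
  have h := hb t ht22
  rw [abs_of_pos ht0] at h
  have hlog2 : Real.log 2 ≤ 1 := by have := Real.log_two_lt_d9; linarith
  -- `log t ≤ 2L`, `log log t ≤ 2 log L`
  have hlt0 : L ≤ Real.log t := Real.log_le_log hT0 ht.1
  have hlt : Real.log t ≤ 2 * L := by
    have h2 : t ≤ T ^ 2 := by nlinarith [ht.2]
    calc Real.log t ≤ Real.log (T ^ 2) := Real.log_le_log ht0 h2
      _ = 2 * L := by rw [Real.log_pow]; push_cast; ring
  have hllt0 : 0 ≤ Real.log (Real.log t) := Real.log_nonneg (by linarith)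
  have hllt : Real.log (Real.log t) ≤ 2 * Real.log L := by
    calc Real.log (Real.log t) ≤ Real.log (2 * L) := Real.log_le_log (by linarith) hlt
      _ = Real.log 2 + Real.log L := Real.log_mul (by norm_num) hL0.ne'
      _ ≤ 2 * Real.log L := by linarith
  have h1 : Real.log t ^ (2 / 3 : ℝ) ≤ (2 * L) ^ (2 / 3 : ℝ) :=
    Real.rpow_le_rpow (by linarith) hlt (by norm_num)
  have h2 : Real.log (Real.log t) ^ (4 / 3 : ℝ) ≤ (2 * Real.log L) ^ (4 / 3 : ℝ) :=
    Real.rpow_le_rpow hllt0 hllt (by norm_num)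
  have h3 : (2 * L) ^ (2 / 3 : ℝ) * (2 * Real.log L) ^ (4 / 3 : ℝ) =
      4 * (L ^ (2 / 3 : ℝ) * Real.log L ^ (4 / 3 : ℝ)) := by
    rw [Real.mul_rpow (by norm_num) hL0.le, Real.mul_rpow (by norm_num) hlogL0.le]
    have e : (2 : ℝ) ^ (2 / 3 : ℝ) * 2 ^ (4 / 3 : ℝ) = 4 := by
      rw [← Real.rpow_add (by norm_num)]; norm_num
    calc 2 ^ (2 / 3 : ℝ) * L ^ (2 / 3 : ℝ) * (2 ^ (4 / 3 : ℝ) * Real.log L ^ (4 / 3 : ℝ))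
        = (2 ^ (2 / 3 : ℝ) * 2 ^ (4 / 3 : ℝ)) * (L ^ (2 / 3 : ℝ) * Real.log L ^ (4 / 3 : ℝ)) := by
          ring
      _ = 4 * (L ^ (2 / 3 : ℝ) * Real.log L ^ (4 / 3 : ℝ)) := by rw [e]
  -- `L^{2/3} (log L)^{4/3} ≤ L / log L`
  have h4 : L ^ (2 / 3 : ℝ) * Real.log L ^ (4 / 3 : ℝ) ≤ L / Real.log L := by
    rw [le_div_iff₀ hlogL0]
    have e1 : L ^ (2 / 3 : ℝ) * Real.log L ^ (4 / 3 : ℝ) * Real.log L =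
        L ^ (2 / 3 : ℝ) * Real.log L ^ (7 / 3 : ℝ) := by
      rw [mul_assoc, ← Real.rpow_add_one hlogL0.ne']; norm_num
    have e2 : L ^ (2 / 3 : ℝ) * L ^ (1 / 3 : ℝ) = L := by
      rw [← Real.rpow_add hL0]; norm_num
    rw [e1]
    calc L ^ (2 / 3 : ℝ) * Real.log L ^ (7 / 3 : ℝ) ≤ L ^ (2 / 3 : ℝ) * L ^ (1 / 3 : ℝ) :=
          mul_le_mul_of_nonneg_left hll (Real.rpow_nonneg hL0.le _)
      _ = L := e2
  have hC0 : 0 ≤ C := hC.le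
  calc ‖deriv riemannZeta (1 + t * I) / riemannZeta (1 + t * I)‖
      ≤ C * Real.log t ^ (2 / 3 : ℝ) * Real.log (Real.log t) ^ (4 / 3 : ℝ) := h
    _ ≤ C * (2 * L) ^ (2 / 3 : ℝ) * (2 * Real.log L) ^ (4 / 3 : ℝ) := by
        gcongr
    _ = 4 * C * (L ^ (2 / 3 : ℝ) * Real.log L ^ (4 / 3 : ℝ)) := by rw [mul_assoc, h3]; ring
    _ ≤ 4 * C * (L / Real.log L) := mul_le_mul_of_nonneg_left h4 (by positivity)

end Lagarias2005LogDeriv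

open Lagarias2005LogDeriv in
/-- **Lagarias 2005, Lemma 4.1 (2)** (RH-FREE): `R_{1/2}(T) = sup_{T ≤ t ≤ T+1} |ζ′/ζ(1+it)| =
O(log T / log log T)` as `T → +∞` — discharged from the Vinogradov–Korobov-strength bound
`Literature.NumberTheory.LFunctions.ZetaLogDerivVK.norm_logDeriv_zeta_one_le`
(`≪ (log t)^{2/3}(log log t)^{4/3}`, which is `o(log t/log log t)`); the printed route is
Titchmarsh's Theorem 5.17 (5.17.4). [cite: Lagarias2005, Lemma 4.1 (2) p.8]
[cite: Titchmarsh1986, Theorem 5.17 (5.17.4)] -/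
theorem lagarias2005_lemma_4_1_2_holds : lagarias2005_lemma_4_1_2 := by
  obtain ⟨C, hC, hb⟩ := ZetaLogDerivVK.norm_logDeriv_zeta_one_le
  rw [lagarias2005_lemma_4_1_2, Asymptotics.isBigO_iff]
  refine ⟨4 * C, ?_⟩
  filter_upwards [eventually_ge_atTop (22 : ℝ), eventually_loglog_rpow_le] with T hT hll
  -- the pointwise bound on `[T, T+1]`, in the shape of `zetaLogDerivSup (1/2) T`
  have e : ∀ t : ℝ, (1 / 2 : ℂ) + ((1 / 2 : ℝ) : ℂ) + t * I = 1 + t * I := by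
    intro t; push_cast; ring
  have key : ∀ t ∈ Icc T (T + 1),
      ‖deriv riemannZeta (1 / 2 + ((1 / 2 : ℝ) : ℂ) + t * I) /
        riemannZeta (1 / 2 + ((1 / 2 : ℝ) : ℂ) + t * I)‖ ≤
        4 * C * (Real.log T / Real.log (Real.log T)) := by
    intro t ht
    rw [e t]
    exact norm_logDeriv_le_gauge hC hb hT hll ht
  have hTmem : T ∈ Icc T (T + 1) := ⟨le_rfl, by linarith⟩
  have hbdd : BddAbove ((fun t : ℝ ↦ ‖deriv riemannZeta (1 / 2 + ((1 / 2 : ℝ) : ℂ) + t * I) /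
      riemannZeta (1 / 2 + ((1 / 2 : ℝ) : ℂ) + t * I)‖) '' Icc T (T + 1)) := by
    refine ⟨4 * C * (Real.log T / Real.log (Real.log T)), ?_⟩
    rintro _ ⟨t, ht, rfl⟩
    exact key t ht
  have hsup_le : zetaLogDerivSup (1 / 2) T ≤ 4 * C * (Real.log T / Real.log (Real.log T)) := by
    rw [zetaLogDerivSup_def]
    refine csSup_le ((nonempty_Icc.2 (by linarith)).image _) ?_
    rintro _ ⟨t, ht, rfl⟩
    exact key t ht
  have hsup_nonneg : 0 ≤ zetaLogDerivSup (1 / 2) T := by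
    rw [zetaLogDerivSup_def]
    exact le_csSup_of_le hbdd ⟨T, hTmem, rfl⟩ (norm_nonneg _)
  rw [Real.norm_eq_abs, abs_of_nonneg hsup_nonneg, Real.norm_eq_abs]
  calc zetaLogDerivSup (1 / 2) T ≤ 4 * C * (Real.log T / Real.log (Real.log T)) := hsup_le
    _ ≤ 4 * C * |Real.log T / Real.log (Real.log T)| :=
        mul_le_mul_of_nonneg_left (le_abs_self _) (by positivity)

end Literature.NumberTheory.LFunctions

end
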